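import Literature.NumberTheory.LFunctions.SchoenfeldExplicit
import Literature.NumberTheory.LFunctions.SchoenfeldExplicitNumerics
import Mathlib.Analysis.Calculus.Deriv.MeanValue
import HarnessLib

/-!
# Schoenfeld 1976, p. 340: the Appel–Rosser bound `0 < {li(x) − π(x)} log x/√x < 2.444` on `[2659, 3169]`, certified

Topic: `Literature/NumberTheory/LFunctions` (trunk T-ANT, family RH). Discharge of the named fact
`Literature.NumberTheory.LFunctions.Schoenfeld1976_eq620'` of `SchoenfeldExplicit.lean`
(L. Schoenfeld, *Sharper bounds for the Chebyshev functions θ(x) and ψ(x). II*, Math. Comp. 30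
(1976), 337–360, proof of Cor. 1, p. 340, the line after (6.20): "For `2659 ≤ x ≤ 3169`, the
inequality (6.20) holds with `2.523` replaced by `2.444`", i.e.
`0 < {li(x) − π(x)}(log x)/√x < 2.444`; Schoenfeld reads it off the Appel–Rosser table of 1961).
Here it is PROVED, for real `x`, by a kernel computation (`decide +kernel`, no extra axioms):

* **Reduction to the integers.** On `[n, n+1)` one has `π(x) = π(n)`; `li` is increasing, so
  `li x − π(n) ≥ li n − π(n)`, and `φ(t) = (li t − π(n)) log t − 2.444 √t` has
  `φ'(t) = 1 + (li t − π(n))/t − 1.222/√t > 0` as soon as `li n > π(n)` (`eq620_interval`,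
  Mathlib's `strictMonoOn_of_deriv_pos` with `li' = 1/log`, `Literature.NumberTheory.LFunctions.hasDerivAt_logIntegral_holds`).
  Hence it suffices that `π(n) < li n` and `(li(n+1) − π(n)) log(n+1) ≤ 2.444 √(n+1)` for the `511`
  integers `2659 ≤ n ≤ 3169`. (The supremum `2.4433…` of the printed quantity is approached from the
  left at the prime `3163`; the margin to `2.444` is `7·10⁻⁴`, so `li(3163) = 463.05…` is needed to
  about `4·10⁻³` — cruder devices such as `(li(n+1) − π(n)) log n/√n` fail there.)
* **Fixed-point `li`.** `liSum` evaluates Ramanujan's series `∑_{j ≤ 36} u^j/(j·j!)` at a dyadic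
  `u = a/2³²` in fixed point `2⁸⁰` with one floor division per term (`liGo_bounds`: error `≤ 36`
  ulps, the pattern of `Literature.Analysis.SpecialFunctions.KernelLog.seriesGo_bounds`); `liUpperFP`/`liLowerFP` add
  `γ` (`EulerMascheroniBounds`, `10⁻⁷`), `log log x` pinched by `log y ≤ y − 1`, `1 − 1/y ≤ log y` at
  `y = u/8`, and the tail `x u³⁷/(37·37!)` — exactly the real-variable enclosures
  `SchoenfeldNumerics.logIntegral_le_of_log_le` / `le_logIntegral_of_le_log` of
  `SchoenfeldExplicitNumerics.lean`, fed with `u ≥ log x` resp. `u ≤ log x` from the kernel logarithm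
  `Literature.Analysis.SpecialFunctions.KernelLog.logIv` (`liHi_sound`, `liLo_sound`; width `≈ 6·10⁻⁵` at `x ≈ 3000`).
* **The walk.** `walk n c fuel` checks `lowerOK n c` (`c·2⁸⁰ < liLowerFP`) and `upperOK (n+1) c`
  (`(1000·D·H)² ≤ 2444²·2³²⁰·(n+1)`, `D ≥ 2⁸⁰(li(n+1) − c)`, `H ≥ 2⁸⁰ log(n+1)`) and steps
  `c ↦ c + [n+1 prime]` by trial division (`isPrimeTD_iff`, both directions), so that `c = π(n)`
  throughout (`walk_sound`, `Nat.count_succ`); `walk 2659 385 511 = some 449` is one kernel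
  evaluation (`≈ 20 s`; `π(2659) = 385` from `SchoenfeldNumerics.primeCounting_2658` and the
  primality of `2659`; the output `449 = π(3170)` is not used).

Everything in this file is proved; the `def`s are the computable checkers.

## References

* L. Schoenfeld, *Sharper bounds for the Chebyshev functions θ(x) and ψ(x). II*, Math. Comp. 30
  (1976), 337–360, proof of Cor. 1, p. 340 ((6.20) and the following sentence). [Schoenfeld1976]
* K. I. Appel, J. B. Rosser, *Table for estimating functions of primes*, IDA-CRD Technical
  Report 4, Princeton 1961 (the table Schoenfeld quotes; not used here).
-/

noncomputable section

open Real Finset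
open Literature.Analysis.SpecialFunctions.KernelLog

namespace Literature.NumberTheory.LFunctions.SchoenfeldNumerics

/-! ### Ramanujan's series in fixed point -/

/-- Fixed-point partial sums of `∑ x^j/(j·j!)`, `x = a/d`: `liGo a d fuel j pow den acc` adds
`⌊a^i 2⁸⁰/(i · dᵢ)⌋`, `dᵢ = d^i · i!`, for `i = j, …, j+fuel-1` (`pow = a^j`, `den = d^j · j!` on
entry; both are carried exactly, one floor division per term). [folklore] -/
def liGo (a : ℤ) (d : ℕ) : ℕ → ℕ → ℤ → ℕ → ℤ → ℤ
  | 0, _, _, _, acc => acc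
  | fuel + 1, j, pow, den, acc =>
      liGo a d fuel (j + 1) (pow * a) (den * (d * (j + 1)))
        (acc + pow * LOGSC / ((j : ℤ) * (den : ℤ)))

/-- `liSum a d m = ∑_{j=1}^{m} ⌊a^j 2⁸⁰/(j · j! · d^j)⌋ ≈ 2⁸⁰ ∑_{j ≤ m} x^j/(j·j!)`, `x = a/d`.
[folklore] -/
def liSum (a : ℤ) (d m : ℕ) : ℤ := liGo a d m 1 a d 0

/-- The exact partial sum `∑_{i=j}^{j+fuel-1} x^i/(i·i!)`. [folklore] -/
noncomputable def liExact (x : ℝ) : ℕ → ℕ → ℝ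
  | 0, _ => 0
  | fuel + 1, j => x ^ j / ((j : ℝ) * (j.factorial : ℝ)) + liExact x fuel (j + 1)

/-- **Fixed-point sum versus exact sum**: with `x = a/d` (`d ≥ 1`), `pow = a^j`,
`den = d^j · j!` (`j ≥ 1`): `liGo ≤ acc + 2⁸⁰·exact ≤ liGo + fuel`. [folklore] -/
theorem liGo_bounds (a : ℤ) {d : ℕ} (hd : 1 ≤ d) :
    ∀ (fuel j : ℕ) (acc : ℤ), 1 ≤ j →
      ((liGo a d fuel j (a ^ j) (d ^ j * j.factorial) acc : ℤ) : ℝ) ≤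
          (acc : ℝ) + (LOGSC : ℝ) * liExact ((a : ℝ) / d) fuel j ∧
        (acc : ℝ) + (LOGSC : ℝ) * liExact ((a : ℝ) / d) fuel j ≤
          ((liGo a d fuel j (a ^ j) (d ^ j * j.factorial) acc : ℤ) : ℝ) + fuel := by
  intro fuel
  induction fuel with
  | zero => intro j acc _; simp [liGo, liExact]
  | succ fuel ih =>
    intro j acc hj
    have hj0 : j ≠ 0 := by omega
    have hdd : (0 : ℤ) < (j : ℤ) * ((d ^ j * j.factorial : ℕ) : ℤ) := by positivity
    obtain ⟨hq1, hq2⟩ := ediv_bounds_real (a ^ j * LOGSC) ((j : ℤ) * ((d ^ j * j.factorial : ℕ) : ℤ)) hdd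
    push_cast at hq1 hq2
    have hdR : (0 : ℝ) < d := by exact_mod_cast hd
    have hterm : (LOGSC : ℝ) * (((a : ℝ) / d) ^ j / ((j : ℝ) * (j.factorial : ℝ))) =
        ((a ^ j * LOGSC : ℤ) : ℝ) / (((j : ℤ) * ((d ^ j * j.factorial : ℕ) : ℤ) : ℤ) : ℝ) := by
      have hjR : (j : ℝ) ≠ 0 := by exact_mod_cast hj0
      have hfR : (j.factorial : ℝ) ≠ 0 := by positivity
      push_cast
      rw [div_pow]
      field_simp
    obtain ⟨r1, r2⟩ :=
      ih (j + 1) (acc + a ^ j * LOGSC / ((j : ℤ) * ((d ^ j * j.factorial : ℕ) : ℤ))) (by omega)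
    have hden : d ^ j * j.factorial * (d * (j + 1)) = d ^ (j + 1) * (j + 1).factorial := by
      rw [Nat.factorial_succ, pow_succ]; ring
    have hstep : liGo a d (fuel + 1) j (a ^ j) (d ^ j * j.factorial) acc =
        liGo a d fuel (j + 1) (a ^ (j + 1)) (d ^ (j + 1) * (j + 1).factorial)
          (acc + a ^ j * LOGSC / ((j : ℤ) * ((d ^ j * j.factorial : ℕ) : ℤ))) := by
      rw [liGo, pow_succ, hden]
    have hex : liExact ((a : ℝ) / d) (fuel + 1) j =
        ((a : ℝ) / d) ^ j / ((j : ℝ) * (j.factorial : ℝ)) + liExact ((a : ℝ) / d) fuel (j + 1) := rfl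
    rw [hstep, hex, mul_add, hterm]
    rw [Int.cast_add] at r1 r2
    push_cast [Nat.cast_succ] at r1 r2 hq1 hq2 ⊢
    constructor
    · linarith
    · linarith

/-- The exact partial sum is Ramanujan's polynomial:
`liExact x m (i+1) = ∑_{k<m} x^{i+k+1}/((i+k+1)(i+k+1)!)`. [folklore] -/
theorem liExact_eq_sum (x : ℝ) : ∀ m i : ℕ,
    liExact x m (i + 1) =
      ∑ k ∈ range m, x ^ (i + k + 1) / (((i + k + 1 : ℕ) : ℝ) * ((i + k + 1).factorial : ℝ)) := by
  intro m
  induction m with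
  | zero => intro i; simp [liExact]
  | succ m ih =>
    intro i
    rw [liExact, Finset.sum_range_succ', ih (i + 1), add_comm]
    congr 1
    refine Finset.sum_congr rfl fun j _ => ?_
    rw [show i + 1 + j + 1 = i + (j + 1) + 1 by ring]

/-- `liExact u N 1` is the partial sum appearing in `logIntegral_le_of_log_le`. [folklore] -/
theorem liExact_one_eq (u : ℝ) (N : ℕ) :
    liExact u N 1 = ∑ k ∈ range N, u ^ (k + 1) / ((k + 1 : ℝ) * ((k + 1).factorial : ℝ)) := by
  rw [liExact_eq_sum u N 0]
  refine Finset.sum_congr rfl fun k _ => ?_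
  simp only [Nat.zero_add, Nat.cast_add, Nat.cast_one]

/-- `2⁸⁰ ∑_{j ≤ m} x^j/(j·j!)` is within `m` ulps above `liSum a d m` (`x = a/d`, `d ≥ 1`).
[folklore] -/
theorem liSum_bounds (a : ℤ) {d : ℕ} (hd : 1 ≤ d) (m : ℕ) :
    ((liSum a d m : ℤ) : ℝ) ≤ 2 ^ 80 * liExact ((a : ℝ) / d) m 1 ∧
      2 ^ 80 * liExact ((a : ℝ) / d) m 1 ≤ ((liSum a d m : ℤ) : ℝ) + m := by
  have h := liGo_bounds a hd m 1 0 le_rfl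
  have hSC : ((LOGSC : ℤ) : ℝ) = 2 ^ 80 := by simp only [LOGSC]; push_cast; ring
  simp only [pow_one, Nat.factorial_one, mul_one, Int.cast_zero, zero_add, hSC] at h
  exact h

/-! ### Fixed-point enclosures of `li n` -/

/-- Number of series terms (`36`; the tail at `x ≈ 3000` is `< 10⁻⁶`). [folklore] -/
def NLI : ℕ := 36

/-- `⌈0.57721571 · 2⁸⁰⌉ ≥ 2⁸⁰ γ` (`EulerMascheroniBounds.lean`). [folklore] -/
def GHI : ℤ := ⌈(0.57721571 : ℚ) * 2 ^ 80⌉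

/-- `⌊0.57721558 · 2⁸⁰⌋ ≤ 2⁸⁰ γ` (`EulerMascheroniBounds.lean`). [folklore] -/
def GLO : ℤ := ⌊(0.57721558 : ℚ) * 2 ^ 80⌋

/-- Denominator `37 · 37! · 2^{32·37}` of the tail term. [folklore] -/
def liTailDen : ℕ := (NLI + 1) * (NLI + 1).factorial * (2 ^ 32) ^ (NLI + 1)

/-- **Upper fixed-point bound for `2⁸⁰ li n` from `u = a/2³² ≥ log n`**:
`2⁸⁰ [0.57721571 + 3 log 2 + u/8 − 1 + ∑_{j ≤ 36} u^j/(j·j!) + n u³⁷/(37·37!)]`, rounded up.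
[folklore] -/
def liUpperFP (n : ℕ) (a : ℤ) : ℤ :=
  GHI + 3 * L2HI + (a * ((2 ^ 45 : ℕ) : ℤ) - LOGSC) + (liSum a (2 ^ 32) NLI + NLI) +
    ((n : ℤ) * (a ^ (NLI + 1) * LOGSC) / (liTailDen : ℤ) + 1)

/-- **Lower fixed-point bound for `2⁸⁰ li n` from `0 < u = b/2³² ≤ log n`**:
`2⁸⁰ [0.57721558 + 3 log 2 + 1 − 8/u + ∑_{j ≤ 36} u^j/(j·j!)]`, rounded down. [folklore] -/
def liLowerFP (b : ℤ) : ℤ :=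
  GLO + 3 * L2LO + (LOGSC - (((2 ^ 115 : ℕ) : ℤ) / b + 1)) + liSum b (2 ^ 32) NLI

/-- `liHi n = some (H, h)` with `log n ≤ H/2⁸⁰` and `li n ≤ h/2⁸⁰` (`liHi_sound`): `H` is the upper
end of `logIv n`, and `h = liUpperFP n a` with `a/2³² ≥ H/2⁸⁰`. [folklore] -/
def liHi (n : ℕ) : Option (ℤ × ℤ) :=
  match logIv n with
  | none => none
  | some (_, hi) => some (hi, liUpperFP n (hi / ((2 ^ 48 : ℕ) : ℤ) + 1))

/-- `liLo n = some l` with `l/2⁸⁰ ≤ li n` (`liLo_sound`): `l = liLowerFP b`, `b/2³² ≤ lo/2⁸⁰` the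
lower end of `logIv n`. [folklore] -/
def liLo (n : ℕ) : Option ℤ :=
  match logIv n with
  | none => none
  | some (lw, _) =>
      if 0 < lw / ((2 ^ 48 : ℕ) : ℤ) then some (liLowerFP (lw / ((2 ^ 48 : ℕ) : ℤ))) else none

/-- `2⁸⁰ log 2 ≤ L2HI`. [folklore] -/
theorem two_pow_mul_log_two_le_L2HI : 2 ^ 80 * Real.log 2 ≤ ((L2HI : ℤ) : ℝ) := by
  have h1 : (0.69314718055994530944 : ℚ) * 2 ^ 80 ≤ ((L2HI : ℤ) : ℚ) := Int.le_ceil _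
  have h2 : (((0.69314718055994530944 : ℚ) * 2 ^ 80 : ℚ) : ℝ) ≤ (((L2HI : ℤ) : ℚ) : ℝ) := by
    exact_mod_cast h1
  have h3 := Literature.Analysis.SpecialFunctions.Real.log_two_lt_d20
  push_cast at h2
  nlinarith

/-- `L2LO ≤ 2⁸⁰ log 2`. [folklore] -/
theorem L2LO_le_two_pow_mul_log_two : ((L2LO : ℤ) : ℝ) ≤ 2 ^ 80 * Real.log 2 := by
  have h1 : ((L2LO : ℤ) : ℚ) ≤ (0.69314718055994530940 : ℚ) * 2 ^ 80 := Int.floor_le _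
  have h2 : (((L2LO : ℤ) : ℚ) : ℝ) ≤ (((0.69314718055994530940 : ℚ) * 2 ^ 80 : ℚ) : ℝ) := by
    exact_mod_cast h1
  have h3 := Literature.Analysis.SpecialFunctions.Real.log_two_gt_d20
  push_cast at h2
  nlinarith

/-- `0.57721571 · 2⁸⁰ ≤ GHI`. [folklore] -/
theorem GHI_ge : (0.57721571 : ℝ) * 2 ^ 80 ≤ ((GHI : ℤ) : ℝ) := by
  have h1 : (0.57721571 : ℚ) * 2 ^ 80 ≤ ((GHI : ℤ) : ℚ) := Int.le_ceil _
  have h2 : (((0.57721571 : ℚ) * 2 ^ 80 : ℚ) : ℝ) ≤ (((GHI : ℤ) : ℚ) : ℝ) := by exact_mod_cast h1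
  push_cast at h2
  exact h2

/-- `GLO ≤ 0.57721558 · 2⁸⁰`. [folklore] -/
theorem GLO_le : ((GLO : ℤ) : ℝ) ≤ (0.57721558 : ℝ) * 2 ^ 80 := by
  have h1 : ((GLO : ℤ) : ℚ) ≤ (0.57721558 : ℚ) * 2 ^ 80 := Int.floor_le _
  have h2 : (((GLO : ℤ) : ℚ) : ℝ) ≤ (((0.57721558 : ℚ) * 2 ^ 80 : ℚ) : ℝ) := by exact_mod_cast h1
  push_cast at h2
  exact h2

/-- **Soundness of `liUpperFP`**: `log n ≤ a/2³²` implies `li n ≤ liUpperFP n a / 2⁸⁰` (`n > 1`).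
[folklore] -/
theorem liUpperFP_sound {n : ℕ} {a : ℤ} (hn : 1 < n) (hU : Real.log n ≤ (a : ℝ) / 2 ^ 32) :
    logIntegral n ≤ ((liUpperFP n a : ℤ) : ℝ) / 2 ^ 80 := by
  have hn' : (1 : ℝ) < n := by exact_mod_cast hn
  set U : ℝ := (a : ℝ) / 2 ^ 32 with hUdef
  have hli := logIntegral_le_of_log_le (x := (n : ℝ)) hn' hU NLI
  -- the series
  obtain ⟨-, hs⟩ := liSum_bounds a (d := 2 ^ 32) (by norm_num) NLI
  have hx : ((a : ℝ) / ((2 ^ 32 : ℕ) : ℝ)) = U := by rw [hUdef]; push_cast; ring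
  rw [hx, liExact_one_eq] at hs
  -- the tail
  have hden : (0 : ℤ) < (liTailDen : ℤ) := by
    have : 0 < liTailDen := by simp only [liTailDen, NLI]; positivity
    exact_mod_cast this
  obtain ⟨-, ht⟩ := ediv_bounds_real ((n : ℤ) * (a ^ (NLI + 1) * LOGSC)) (liTailDen : ℤ) hden
  have hSC : ((LOGSC : ℤ) : ℝ) = 2 ^ 80 := by simp only [LOGSC]; push_cast; ring
  have htail : 2 ^ 80 * ((n : ℝ) * (U ^ (NLI + 1) / ((NLI + 1 : ℝ) * ((NLI + 1).factorial : ℝ)))) =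
      (((n : ℤ) * (a ^ (NLI + 1) * LOGSC) : ℤ) : ℝ) / (((liTailDen : ℕ) : ℤ) : ℝ) := by
    push_cast [liTailDen, hSC]
    rw [hUdef, div_pow]
    field_simp
    ring
  -- log 2, γ, and the linear term
  have hL2 := two_pow_mul_log_two_le_L2HI
  have hG := GHI_ge
  have hlin : 2 ^ 80 * (U / 8 - 1) = (a : ℝ) * 2 ^ 45 - 2 ^ 80 := by rw [hUdef]; ring
  rw [le_div_iff₀ (by positivity)]
  push_cast [liUpperFP, hSC]
  have hmain := mul_le_mul_of_nonneg_right hli (by positivity : (0 : ℝ) ≤ 2 ^ 80)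
  rw [← htail] at ht
  nlinarith [hmain, hs, ht, hL2, hG, hlin]

/-- **Soundness of `liLowerFP`**: `0 < b`, `b/2³² ≤ log n` imply `liLowerFP b / 2⁸⁰ ≤ li n`
(`n > 1`). [folklore] -/
theorem liLowerFP_sound {n : ℕ} {b : ℤ} (hn : 1 < n) (hb : 0 < b)
    (hL : (b : ℝ) / 2 ^ 32 ≤ Real.log n) :
    ((liLowerFP b : ℤ) : ℝ) / 2 ^ 80 ≤ logIntegral n := by
  have hn' : (1 : ℝ) < n := by exact_mod_cast hn
  set L : ℝ := (b : ℝ) / 2 ^ 32 with hLdef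
  have hbR : (0 : ℝ) < b := by exact_mod_cast hb
  have hL0 : 0 < L := by positivity
  have hli := le_logIntegral_of_le_log (x := (n : ℝ)) hn' hL0 hL NLI
  -- the series
  obtain ⟨hs, -⟩ := liSum_bounds b (d := 2 ^ 32) (by norm_num) NLI
  have hx : ((b : ℝ) / ((2 ^ 32 : ℕ) : ℝ)) = L := by rw [hLdef]; push_cast; ring
  rw [hx, liExact_one_eq] at hs
  -- `8/L = 2¹¹⁵/(2⁸⁰ b)`
  obtain ⟨-, hq⟩ := ediv_bounds_real (((2 ^ 115 : ℕ) : ℤ)) b hb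
  have h8 : 2 ^ 80 * (8 / L) = ((((2 ^ 115 : ℕ) : ℤ) : ℤ) : ℝ) / (b : ℝ) := by
    rw [hLdef]; push_cast; field_simp; ring
  have hL2 := L2LO_le_two_pow_mul_log_two
  have hG := GLO_le
  have hSC : ((LOGSC : ℤ) : ℝ) = 2 ^ 80 := by simp only [LOGSC]; push_cast; ring
  rw [div_le_iff₀ (by positivity)]
  push_cast [liLowerFP, hSC]
  have hmain := mul_le_mul_of_nonneg_right hli (by positivity : (0 : ℝ) ≤ 2 ^ 80)
  rw [← h8] at hq
  push_cast at hq
  linarith [hmain, hs, hq, hL2, hG]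

/-- **Soundness of `liHi`.** [folklore] -/
theorem liHi_sound {n : ℕ} {H h : ℤ} (hn : 1 < n) (he : liHi n = some (H, h)) :
    Real.log n ≤ (H : ℝ) / 2 ^ 80 ∧ logIntegral n ≤ (h : ℝ) / 2 ^ 80 := by
  unfold liHi at he
  rcases hl : logIv n with _ | ⟨lw, hi⟩
  · simp [hl] at he
  simp only [hl, Option.some.injEq, Prod.mk.injEq] at he
  obtain ⟨rfl, rfl⟩ := he
  have hlog := (logIv_sound hl).2
  refine ⟨hlog, liUpperFP_sound hn (hlog.trans ?_)⟩
  have h48 : (0 : ℤ) < ((2 ^ 48 : ℕ) : ℤ) := by positivity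
  obtain ⟨-, hq⟩ := ediv_bounds_real hi (((2 ^ 48 : ℕ) : ℤ)) h48
  generalize hi / ((2 ^ 48 : ℕ) : ℤ) = q at hq ⊢
  push_cast at hq ⊢
  rw [div_le_iff₀ (by positivity)] at hq
  rw [div_le_div_iff₀ (by positivity) (by positivity)]
  linarith [hq]

/-- **Soundness of `liLo`.** [folklore] -/
theorem liLo_sound {n : ℕ} {l : ℤ} (hn : 1 < n) (he : liLo n = some l) :
    (l : ℝ) / 2 ^ 80 ≤ logIntegral n := by
  unfold liLo at he
  rcases hl : logIv n with _ | ⟨lw, hi⟩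
  · simp [hl] at he
  simp only [hl] at he
  split_ifs at he with hb
  simp only [Option.some.injEq] at he
  subst he
  have hlog := (logIv_sound hl).1
  refine liLowerFP_sound hn hb (le_trans ?_ hlog)
  have h48 : (0 : ℤ) < ((2 ^ 48 : ℕ) : ℤ) := by positivity
  obtain ⟨hq, -⟩ := ediv_bounds_real lw (((2 ^ 48 : ℕ) : ℤ)) h48
  generalize lw / ((2 ^ 48 : ℕ) : ℤ) = q at hq hb ⊢
  push_cast at hq ⊢
  rw [le_div_iff₀ (by positivity)] at hq
  rw [div_le_div_iff₀ (by positivity) (by positivity)]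
  linarith [hq]

/-! ### The checks and the walk over `n = 2659, …, 3169` -/

/-- `lowerOK n c`: `c · 2⁸⁰ < liLo n`, so that `c < li n`. [folklore] -/
def lowerOK (n c : ℕ) : Bool :=
  match liLo n with
  | some l => decide ((c : ℤ) * LOGSC < l)
  | none => false

/-- `upperOK q c`: with `(H, h) = liHi q` and `D = h − c·2⁸⁰`: `0 ≤ D`, `0 ≤ H` and
`(1000·D·H)² ≤ 2444²·2¹⁶⁰·2¹⁶⁰·q`, so that `(li q − c) log q ≤ 2.444 √q`. [folklore] -/
def upperOK (q c : ℕ) : Bool :=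
  match liHi q with
  | some (H, h) =>
      decide (0 ≤ h - (c : ℤ) * LOGSC) && decide (0 ≤ H) &&
        decide ((1000 * (h - (c : ℤ) * LOGSC) * H) ^ 2 ≤
          5973136 * (((2 ^ 160 : ℕ) : ℤ) * ((2 ^ 160 : ℕ) : ℤ)) * (q : ℤ))
  | none => false

/-- The walk: `walk n c fuel` checks `lowerOK m c_m ∧ upperOK (m+1) c_m` for `m = n, …, n+fuel-1`,
where `c_n = c` and `c_{m+1} = c_m + [m+1 is prime]` (trial division), and returns the final count
(`none` on failure). [folklore] -/
def walk : ℕ → ℕ → ℕ → Option ℕ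
  | _, c, 0 => some c
  | n, c, fuel + 1 =>
      if lowerOK n c && upperOK (n + 1) c then
        walk (n + 1) (if isPrimeTD (n + 1) then c + 1 else c) fuel
      else none

/-- **Soundness of `lowerOK`**: `c < li n`. [folklore] -/
theorem lowerOK_sound {n c : ℕ} (hn : 1 < n) (h : lowerOK n c = true) :
    (c : ℝ) < logIntegral n := by
  unfold lowerOK at h
  rcases he : liLo n with _ | l
  · simp [he] at h
  simp only [he, decide_eq_true_eq] at h
  have h1 := liLo_sound hn he
  have hSC : ((LOGSC : ℤ) : ℝ) = 2 ^ 80 := by simp only [LOGSC]; push_cast; ring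
  have h2 : (((c : ℤ) * LOGSC : ℤ) : ℝ) < ((l : ℤ) : ℝ) := by exact_mod_cast h
  push_cast [hSC] at h2
  rw [div_le_iff₀ (by positivity)] at h1
  nlinarith

/-- **Soundness of `upperOK`**: `(li q − c) log q ≤ 2.444 √q`. [folklore] -/
theorem upperOK_sound {q c : ℕ} (hq : 1 < q) (h : upperOK q c = true) :
    (logIntegral q - c) * Real.log q ≤ 2.444 * √(q : ℝ) := by
  unfold upperOK at h
  rcases he : liHi q with _ | ⟨H, hh⟩
  · simp [he] at h
  simp only [he, Bool.and_eq_true, decide_eq_true_eq] at h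
  obtain ⟨⟨hD, hH⟩, hsq⟩ := h
  obtain ⟨hlog, hli⟩ := liHi_sound hq he
  have hSC : ((LOGSC : ℤ) : ℝ) = 2 ^ 80 := by simp only [LOGSC]; push_cast; ring
  have hlogq : 0 < Real.log q := Real.log_pos (by exact_mod_cast hq)
  have hsqrt : (0 : ℝ) ≤ 2.444 * √(q : ℝ) := by positivity
  rcases le_or_gt 0 (logIntegral q - c) with hpos | hneg
  · generalize hDdef : hh - (c : ℤ) * LOGSC = D at hD hsq
    have hDR : ((D : ℤ) : ℝ) = hh - c * 2 ^ 80 := by rw [← hDdef]; push_cast [hSC]; ring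
    have hD0 : (0 : ℝ) ≤ D := by exact_mod_cast hD
    have hH0 : (0 : ℝ) ≤ H := by exact_mod_cast hH
    have hDreal : logIntegral q - c ≤ (D : ℝ) / 2 ^ 80 := by
      rw [hDR, le_div_iff₀ (by positivity)]
      have := (le_div_iff₀ (by positivity : (0:ℝ) < 2 ^ 80)).1 hli
      linarith
    have step1 : (logIntegral q - c) * Real.log q ≤ (D : ℝ) / 2 ^ 80 * ((H : ℝ) / 2 ^ 80) :=
      mul_le_mul hDreal hlog hlogq.le (by positivity)
    refine step1.trans ?_
    have hsqR : (((1000 * D * H) ^ 2 : ℤ) : ℝ) ≤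
        ((5973136 * (((2 ^ 160 : ℕ) : ℤ) * ((2 ^ 160 : ℕ) : ℤ)) * (q : ℤ) : ℤ) : ℝ) := by
      exact_mod_cast hsq
    push_cast at hsqR
    have hlhs : 0 ≤ (D : ℝ) / 2 ^ 80 * ((H : ℝ) / 2 ^ 80) := by positivity
    rw [show (2.444 : ℝ) * √(q : ℝ) = √((2.444 : ℝ) ^ 2 * q) by
      rw [Real.sqrt_mul (by positivity), Real.sqrt_sq (by norm_num)]]
    rw [Real.le_sqrt hlhs (by positivity)]
    rw [show (D : ℝ) / 2 ^ 80 * ((H : ℝ) / 2 ^ 80) = (1000 * D * H) / (1000 * 2 ^ 160) by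
      rw [eq_div_iff (by positivity)]; ring]
    rw [div_pow, div_le_iff₀ (by positivity)]
    nlinarith [hsqR]
  · have : (logIntegral q - c) * Real.log q < 0 := mul_neg_of_neg_of_pos hneg hlogq
    linarith

/-- Completeness of trial division: no divisor in `[2, k]` gives `noDiv n k = true`. [folklore] -/
theorem noDiv_complete (n : ℕ) :
    ∀ k : ℕ, (∀ m : ℕ, 2 ≤ m → m ≤ k → ¬ m ∣ n) → noDiv n k = true
  | 0, _ => rfl
  | 1, _ => rfl
  | k + 2, h => by
      simp only [noDiv, Bool.and_eq_true, bne_iff_ne, ne_eq]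
      exact ⟨fun hmod => h (k + 2) (by omega) le_rfl (Nat.dvd_of_mod_eq_zero hmod),
        noDiv_complete n (k + 1) fun m hm hmk => h m hm (by omega)⟩

/-- `isPrimeTD` decides primality (`Nat.prime_def_le_sqrt`). [folklore] -/
theorem isPrimeTD_iff {n : ℕ} : isPrimeTD n = true ↔ n.Prime := by
  refine ⟨prime_of_isPrimeTD, fun hp => ?_⟩
  simp only [isPrimeTD, Bool.and_eq_true, decide_eq_true_eq]
  refine ⟨hp.two_le, noDiv_complete n _ fun m hm hmk hdvd => ?_⟩
  rcases (Nat.dvd_prime hp).1 hdvd with rfl | rfl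
  · omega
  · have := Nat.sqrt_lt_self hp.one_lt
    omega

/-- `π(n+1) = π(n) + [n+1 is prime]` (`Nat.count_succ`). [folklore] -/
theorem primeCounting_succ (n : ℕ) :
    Nat.primeCounting (n + 1) = Nat.primeCounting n + if (n + 1).Prime then 1 else 0 := by
  simp only [Nat.primeCounting, Nat.primeCounting', Nat.count_succ]

/-- **Soundness of the walk**: started with `c = π(n)`, a successful `walk n c fuel` certifies
`lowerOK m (π m)` and `upperOK (m+1) (π m)` for `n ≤ m < n + fuel` (and returns `π(n + fuel)`).
[folklore] -/
theorem walk_sound : ∀ (fuel n c : ℕ) {c' : ℕ}, walk n c fuel = some c' →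
    Nat.primeCounting n = c →
      (∀ m : ℕ, n ≤ m → m < n + fuel →
        lowerOK m (Nat.primeCounting m) = true ∧ upperOK (m + 1) (Nat.primeCounting m) = true) ∧
      Nat.primeCounting (n + fuel) = c'
  | 0, n, c, c', h, hc => by
      simp only [walk, Option.some.injEq] at h
      refine ⟨fun m h1 h2 => by omega, ?_⟩
      rw [Nat.add_zero, hc, h]
  | fuel + 1, n, c, c', h, hc => by
      cases hok : (lowerOK n c && upperOK (n + 1) c)
      · simp [walk, hok] at h
      · simp only [walk, hok, if_true] at h
        obtain ⟨h1, h2⟩ := Bool.and_eq_true_iff.1 hok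
        have hc1 : Nat.primeCounting (n + 1) = (if isPrimeTD (n + 1) = true then c + 1 else c) := by
          rw [primeCounting_succ, hc]
          by_cases hp : (n + 1).Prime
          · simp [hp, isPrimeTD_iff.2 hp]
          · simp [hp, mt isPrimeTD_iff.1 hp]
        obtain ⟨ih1, ih2⟩ := walk_sound fuel (n + 1) _ h hc1
        refine ⟨fun m hm1 hm2 => ?_, by rw [← ih2]; ring_nf⟩
        rcases Nat.eq_or_lt_of_le hm1 with rfl | hlt
        · subst hc; exact ⟨h1, h2⟩
        · exact ih1 m hlt (by omega)

/-- `π(2659) = 385` (`π(2658) = 384` and `2659` is prime). [folklore] -/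
theorem primeCounting_2659 : Nat.primeCounting 2659 = 385 := by
  rw [primeCounting_succ 2658, primeCounting_2658,
    if_pos (isPrimeTD_iff.1 (by decide +kernel : isPrimeTD 2659 = true))]

/-- **The kernel computation**: all `511` checks pass (and `π(3170) = 449`). About `20 s` of kernel
time. [folklore] -/
theorem walk_2659 : walk 2659 385 511 = some 449 := by
  decide +kernel

/-- The checks hold at every integer `2659 ≤ n ≤ 3169`: `π(n) < li n` and
`(li(n+1) − π(n)) log(n+1) ≤ 2.444 √(n+1)`. [folklore] -/
theorem checks_2659_3169 {n : ℕ} (h1 : 2659 ≤ n) (h2 : n ≤ 3169) :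
    (Nat.primeCounting n : ℝ) < logIntegral n ∧
      (logIntegral ((n + 1 : ℕ) : ℝ) - Nat.primeCounting n) * Real.log ((n + 1 : ℕ) : ℝ) ≤
        2.444 * √((n + 1 : ℕ) : ℝ) := by
  obtain ⟨hall, -⟩ := walk_sound 511 2659 385 walk_2659 primeCounting_2659
  obtain ⟨hl, hu⟩ := hall n h1 (by omega)
  exact ⟨lowerOK_sound (by omega) hl, upperOK_sound (by omega) hu⟩

/-! ### From the integer checks to real `x` -/

/-- **One unit interval.** If `c < li n` and `(li(n+1) − c) log(n+1) ≤ 2.444 √(n+1)` (`n ≥ 2`),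
then `0 < (li x − c) log x/√x < 2.444` for `n ≤ x < n+1`: `li` is increasing, and
`φ(t) = (li t − c) log t − 2.444 √t` has `φ' = 1 + (li t − c)/t − 1.222/√t > 0` on `[n, n+1]`.
[folklore] -/
theorem eq620_interval {n c : ℕ} (hn : 2 ≤ n) (hlo : (c : ℝ) < logIntegral n)
    (hup : (logIntegral ((n : ℝ) + 1) - c) * Real.log ((n : ℝ) + 1) ≤ 2.444 * √((n : ℝ) + 1))
    {x : ℝ} (hnx : (n : ℝ) ≤ x) (hxn : x < n + 1) :
    0 < (logIntegral x - c) * Real.log x / √x ∧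
      (logIntegral x - c) * Real.log x / √x < 2.444 := by
  have hn2 : (2 : ℝ) ≤ n := by exact_mod_cast hn
  have hn1 : (n : ℝ) ∈ Set.Ioi (1 : ℝ) := by simp only [Set.mem_Ioi]; linarith
  have hx1 : 1 < x := by linarith
  have hmono := strictMonoOn_logIntegral_holds.monotoneOn
  have hlix : logIntegral n ≤ logIntegral x := hmono hn1 (show x ∈ Set.Ioi (1 : ℝ) from hx1) hnx
  have hpos : 0 < logIntegral x - c := by linarith
  have hlogx : 0 < Real.log x := Real.log_pos hx1
  have hsx : 0 < √x := Real.sqrt_pos.2 (by linarith)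
  refine ⟨div_pos (mul_pos hpos hlogx) hsx, ?_⟩
  rw [div_lt_iff₀ hsx]
  -- `φ` and its derivative
  set φ : ℝ → ℝ := fun t => (logIntegral t - c) * Real.log t - 2.444 * √t with hφ
  have hderiv : ∀ t : ℝ, (n : ℝ) ≤ t → HasDerivAt φ
      ((Real.log t)⁻¹ * Real.log t + (logIntegral t - c) * t⁻¹ - 2.444 * (1 / (2 * √t))) t := by
    intro t ht
    have ht1 : 1 < t := by linarith
    have ht0 : t ≠ 0 := by positivity
    have h1 : HasDerivAt logIntegral (Real.log t)⁻¹ t := hasDerivAt_logIntegral_holds ht1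
    exact ((h1.sub_const (c : ℝ)).mul (Real.hasDerivAt_log ht0)).sub
      ((Real.hasDerivAt_sqrt ht0).const_mul (2.444 : ℝ))
  have hsm : StrictMonoOn φ (Set.Icc (n : ℝ) (n + 1)) := by
    refine strictMonoOn_of_deriv_pos (convex_Icc _ _)
      (fun t ht => (hderiv t ht.1).continuousAt.continuousWithinAt) ?_
    intro t ht
    rw [interior_Icc] at ht
    rw [(hderiv t ht.1.le).deriv]
    have ht1 : 1 < t := by linarith [ht.1]
    have htpos : 0 < t := by linarith
    have hlt : logIntegral n ≤ logIntegral t :=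
      hmono hn1 (show t ∈ Set.Ioi (1 : ℝ) from ht1) ht.1.le
    have hpos' : 0 < logIntegral t - c := by linarith
    have hst : (1.222 : ℝ) < √t := by
      rw [Real.lt_sqrt (by norm_num)]
      nlinarith [ht.1]
    have hs0 : 0 < √t := by linarith
    rw [inv_mul_cancel₀ (Real.log_pos ht1).ne']
    have h3 : 0 < (logIntegral t - c) * t⁻¹ := mul_pos hpos' (inv_pos.2 htpos)
    have h4 : (2.444 : ℝ) * (1 / (2 * √t)) < 1 := by
      rw [mul_one_div, div_lt_one (by positivity)]
      linarith
    linarith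
  have hxmem : x ∈ Set.Icc (n : ℝ) (n + 1) := ⟨hnx, hxn.le⟩
  have hn1mem : (n : ℝ) + 1 ∈ Set.Icc (n : ℝ) (n + 1) := ⟨by linarith, le_rfl⟩
  have hlt := hsm hxmem hn1mem hxn
  simp only [hφ] at hlt
  linarith

end SchoenfeldNumerics

/-- **Discharge of `Schoenfeld1976_eq620'`** (Schoenfeld 1976, p. 340, the sentence after (6.20):
"For `2659 ≤ x ≤ 3169`, the inequality (6.20) holds with `2.523` replaced by `2.444`", which
Schoenfeld takes from the Appel–Rosser table): for real `2659 ≤ x ≤ 3169`,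
`0 < {li(x) − π(x)}(log x)/√x < 2.444`. Certified here by kernel computation: fixed-point
enclosures of `li` at the integers `2659, …, 3170`, exact `π(n)` by trial division, and the
monotonicity of `(li t − π(n)) log t − 2.444 √t` on each `[n, n+1]`
(`SchoenfeldNumerics.eq620_interval`, `SchoenfeldNumerics.checks_2659_3169`). The supremum of the
middle quantity on this range is `2.4433…`, approached as `x → 3163⁻`.
[cite: Schoenfeld1976, proof of Cor. 1, p. 340 ((6.20) with 2.444 on [2659, 3169])] -/
theorem Schoenfeld1976_eq620'_holds : Schoenfeld1976_eq620' := by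
  intro x hx hx'
  have hx0 : 0 ≤ x := by linarith
  have hn1 : 2659 ≤ ⌊x⌋₊ := Nat.le_floor (by exact_mod_cast hx)
  have hn2 : ⌊x⌋₊ ≤ 3169 := by
    have := Nat.floor_le_floor hx'
    simpa using this
  have hnx : ((⌊x⌋₊ : ℕ) : ℝ) ≤ x := Nat.floor_le hx0
  have hxn : x < (⌊x⌋₊ : ℕ) + 1 := Nat.lt_floor_add_one x
  obtain ⟨hlo, hup⟩ := SchoenfeldNumerics.checks_2659_3169 hn1 hn2
  push_cast at hup
  exact SchoenfeldNumerics.eq620_interval (by omega) hlo hup hnx hxn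

end Literature.NumberTheory.LFunctions
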